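import Mathlib
import Literature.NumberTheory.Sieve.VinogradovExpSumTools
import Literature.NumberTheory.LFunctions.MauduitRivatFourier
import HarnessLib

/-!
# The discrete Fourier transform of `e(α s₂(n))`: Mauduit–Rivat's product formula and uniform bound (base 2) — proved

Topic `Literature/NumberTheory/LFunctions` (digital exponential sums; companion of the Mauduit–Rivat /
Bourgain files `MoebiusWalsh*`, `MauduitRivatTypeII*`). For the binary sum-of-digits function
`s₂(u) = (Nat.digits 2 u).sum` and real `α`, `h`, the normalised discrete Fourier transform of the
`2^λ`-periodic phase `e(α s₂(u))`,

  `F_λ(h, α) = 2^{-λ} Σ_{u < 2^λ} e(α s₂(u) − h u 2^{-λ})`      (`fourierCoeff`, `e(x) = exp(2πix)`),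

is the object of C. Mauduit, J. Rivat, *La somme des chiffres des carrés*, Acta Math. **203** (2009)
107–148 [MauduitRivat2009], §4.2 (15), with `q = 2`. Everything in this file is PROVED:

* `fourierCoeff_succ`, `norm_fourierCoeff_eq_prod` — the recursion in the last digit and the PRODUCT
  FORMULA (17): `|F_λ(h, α)| = Π_{1 ≤ j ≤ λ} |cos π(α − h 2^{-j})|` (`φ₂(t)/2 = |cos πt|`);
* `abs_cos_mul_abs_cos_le` — Lemme 7 for `q = 2`: `|cos π(θ − t)|·|cos π(θ − 2t)| ≤ exp(−π²‖θ‖²/18)`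
  for all real `θ, t` (`‖·‖ = distInt`, distance to the nearest integer): from `‖θ‖ ≤ 2‖θ − t‖ + ‖θ − 2t‖`
  one of the two distances is `≥ ‖θ‖/3`, and `|cos πx| = cos(π‖x‖) ≤ cos(π‖θ‖/3) ≤ exp(−π²‖θ‖²/18)`
  (`cos u ≤ exp(−u²/2)` for `|u| ≤ 1`, `cos_le_exp_neg_sq_half`);
* `prod_abs_cos_le` — pairing consecutive factors: `Π_{1≤j≤λ} |cos π(α − h2^{-j})| ≤ e^{π²/144} e^{−π²‖α‖²λ/36}`;
* the NAMED FACT `mauduitRivat_fourier_sup_base2` = Lemme 9 for `q = 2` as printed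
  (`|F_λ(h, α)| ≤ e^{π²/48} 2^{−c₂‖α‖²λ}`, `c₂ = π²/(12 log 2)·(1 − 2/3) = π²/(36 log 2)`, `λ ≥ 2`, `h ∈ ℤ`)
  and its DISCHARGE `mauduitRivat_fourier_sup_base2_holds`, together with the slightly stronger real-shift
  form `norm_fourierCoeff_le` (all `λ`, all real `h`, constant `e^{π²/144}`);
* `digitSum_eq_card_testBit` — the bridge `s₂(u) = #{i < n : testBit u i}` for `u < 2ⁿ` to the
  Hamming-weight vocabulary of the circuit files; `digitSum_mul_two_pow` (`s₂(u 2^a) = s₂(u)`);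
* `hasFourierProperty_exp_digitSum` — the same bound packaged as
  `MauduitRivat.HasFourierProperty 2 γ c (e(α s₂ ·))` for EVERY `c`, with
  `γ(λ) = (π²/(36 log 2))‖α‖²λ − π²/(144 log 2)` (the tree's form of Mauduit–Rivat 2015 Def. 2 /
  Müllner 2017 Def. 4.2, file `MauduitRivatFourier.lean`).

This is the "Fourier property" `f ∈ F_{γ,c}` of `f = e(α s₂)` quoted by Mauduit–Rivat, J. Eur. Math.
Soc. 17 (2015), p. 2598 ("it follows from [MR2009, Lemmas 16 and 9] …"), i.e. the digit-side input of
every Mauduit–Rivat type bound for `Σ Λ(n) e(α s₂(n))`, `Σ μ(n) e(α s₂(n))`, `Σ λ(n) e(α s₂(n))`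
(e.g. the hypothesis `GelfondLiouvilleDecay` of the symmetric-digital rung of crux
`MobiusLadder.LiouvilleOrthogonalTC0`). NOT here: the carry property (Lemme 16), the `L¹`/large-sieve
bounds (Lemmes 8, 10–14), general bases `q ≥ 3`.
-/

noncomputable section

namespace Literature.NumberTheory.LFunctions

open Finset
open scoped FourierTransform
open Literature.NumberTheory.Sieve.Vinogradov (distInt distInt_nonneg distInt_le_half distInt_add_le
  distInt_neg distInt_le_abs_sub_int)

namespace SumOfDigits

/-! ### Binary digits -/

/-- The last binary digit splits off the digit sum: `s₂(2u + i) = i + s₂(u)` for `i ∈ {0, 1}`. [folklore] -/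
theorem digitSum_two_mul_add (u : ℕ) {i : ℕ} (hi : i < 2) :
    (Nat.digits 2 (2 * u + i)).sum = i + (Nat.digits 2 u).sum := by
  rcases Nat.eq_zero_or_pos (2 * u + i) with h0 | hpos
  · have hu : u = 0 := by omega
    have hi0 : i = 0 := by omega
    subst hu; subst hi0; simp
  · rw [Nat.digits_def' (by norm_num) hpos]
    have h1 : (2 * u + i) % 2 = i := by omega
    have h2 : (2 * u + i) / 2 = u := by omega
    rw [h1, h2, List.sum_cons]

/-- A sum over `range (2n)` split according to the last binary digit. [folklore] -/
theorem sum_range_two_mul {M : Type*} [AddCommMonoid M] (f : ℕ → M) (n : ℕ) :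
    ∑ u ∈ range (2 * n), f u = ∑ u ∈ range n, (f (2 * u) + f (2 * u + 1)) := by
  induction n with
  | zero => simp
  | succ n ih =>
      rw [show 2 * (n + 1) = 2 * n + 1 + 1 by ring, sum_range_succ, sum_range_succ, ih, sum_range_succ,
        add_assoc]

/-- **The digit sum is the Hamming weight of the digits**: for `u < 2ⁿ`,
`s₂(u) = #{i < n : testBit u i}`. [folklore] -/
theorem digitSum_eq_card_testBit : ∀ (n u : ℕ), u < 2 ^ n →
    (Nat.digits 2 u).sum = ((range n).filter fun i => Nat.testBit u i = true).card
  | 0, u, hu => by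
      have : u = 0 := by simpa using hu
      subst this; simp
  | n + 1, u, hu => by
      -- `u = 2 u' + i`
      obtain ⟨u', i, hi, rfl⟩ : ∃ u' i : ℕ, i < 2 ∧ u = 2 * u' + i :=
        ⟨u / 2, u % 2, Nat.mod_lt _ (by norm_num), (Nat.div_add_mod u 2).symm⟩
      have hu' : u' < 2 ^ n := by rw [pow_succ] at hu; omega
      rw [digitSum_two_mul_add u' hi, digitSum_eq_card_testBit n u' hu', card_filter, card_filter,
        sum_range_succ']
      have hdiv : (2 * u' + i) / 2 = u' := by omega
      have hmod : (2 * u' + i) % 2 = i := by omega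
      simp only [Nat.testBit_succ, hdiv, Nat.testBit_zero, hmod, decide_eq_true_eq]
      rcases (show i = 0 ∨ i = 1 by omega) with rfl | rfl <;> simp [add_comm]

/-! ### Mauduit–Rivat's `F_λ(h, α)` for `q = 2` -/

/-- **`F_λ(h, α)`** (Mauduit–Rivat 2009, (15), base `q = 2`, real shift `h`):
`fourierCoeff λ h α = 2^{-λ} Σ_{u<2^λ} e(α s₂(u) − h u 2^{-λ})`. For `h ∈ ℤ` this is the `h`-th discrete
Fourier coefficient of the `2^λ`-periodic sequence `e(α s₂(u mod 2^λ))`. [cite: MauduitRivat2009, (15)] -/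
def fourierCoeff (lam : ℕ) (h α : ℝ) : ℂ :=
  (∑ u ∈ range (2 ^ lam),
      Complex.exp (((2 * Real.pi * (α * ((Nat.digits 2 u).sum : ℕ) - h * u / 2 ^ lam) : ℝ) : ℂ) *
        Complex.I)) / 2 ^ lam

/-- `F_0(h, α) = 1`. [cite: MauduitRivat2009, (16)] -/
theorem fourierCoeff_zero (h α : ℝ) : fourierCoeff 0 h α = 1 := by
  simp [fourierCoeff]

/-- **Recursion in the last digit**: `F_{λ+1}(h, α) = ½(1 + e(α − h 2^{-(λ+1)})) · F_λ(h, α)`.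
[cite: MauduitRivat2009, §4.2 (16)–(17)] -/
theorem fourierCoeff_succ (lam : ℕ) (h α : ℝ) :
    fourierCoeff (lam + 1) h α =
      (1 + Complex.exp (((2 * Real.pi * (α - h / 2 ^ (lam + 1))) : ℝ) * Complex.I)) / 2 *
        fourierCoeff lam h α := by
  have hsplit : Finset.range (2 ^ (lam + 1)) = Finset.range (2 * 2 ^ lam) := by
    rw [pow_succ, mul_comm]
  unfold fourierCoeff
  rw [hsplit, sum_range_two_mul]
  have key : ∀ u ∈ range (2 ^ lam),
      Complex.exp (((2 * Real.pi * (α * ((Nat.digits 2 (2 * u)).sum : ℕ) -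
          h * ((2 * u : ℕ) : ℝ) / 2 ^ (lam + 1))) : ℝ) * Complex.I) +
      Complex.exp (((2 * Real.pi * (α * ((Nat.digits 2 (2 * u + 1)).sum : ℕ) -
          h * ((2 * u + 1 : ℕ) : ℝ) / 2 ^ (lam + 1))) : ℝ) * Complex.I)
        = (1 + Complex.exp (((2 * Real.pi * (α - h / 2 ^ (lam + 1))) : ℝ) * Complex.I)) *
          Complex.exp (((2 * Real.pi * (α * ((Nat.digits 2 u).sum : ℕ) - h * u / 2 ^ lam) : ℝ) : ℂ) *
            Complex.I) := by
    intro u _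
    have h0 := digitSum_two_mul_add u (i := 0) (by norm_num)
    have h1 := digitSum_two_mul_add u (i := 1) (by norm_num)
    simp only [add_zero, zero_add] at h0
    have hA : (((2 * Real.pi * (α * ((Nat.digits 2 (2 * u)).sum : ℕ) -
          h * ((2 * u : ℕ) : ℝ) / 2 ^ (lam + 1))) : ℝ) : ℂ) * Complex.I =
        ((2 * Real.pi * (α * ((Nat.digits 2 u).sum : ℕ) - h * u / 2 ^ lam) : ℝ) : ℂ) * Complex.I := by
      rw [h0]; congr 1; push_cast; ring
    have hB : (((2 * Real.pi * (α * ((Nat.digits 2 (2 * u + 1)).sum : ℕ) -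
          h * ((2 * u + 1 : ℕ) : ℝ) / 2 ^ (lam + 1))) : ℝ) : ℂ) * Complex.I =
        ((2 * Real.pi * (α - h / 2 ^ (lam + 1)) : ℝ) : ℂ) * Complex.I +
        ((2 * Real.pi * (α * ((Nat.digits 2 u).sum : ℕ) - h * u / 2 ^ lam) : ℝ) : ℂ) * Complex.I := by
      rw [h1, ← add_mul]; congr 1; push_cast; ring
    rw [hA, hB, Complex.exp_add]; ring
  rw [Finset.sum_congr rfl key, ← Finset.mul_sum]
  push_cast
  ring

/-- `|½(1 + e(θ))| = |cos πθ|` (`φ₂(θ)/2` in Mauduit–Rivat's notation). [folklore] -/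
theorem norm_one_add_exp_div_two (θ : ℝ) :
    ‖(1 + Complex.exp (((2 * Real.pi * θ : ℝ) : ℂ) * Complex.I)) / 2‖ = |Real.cos (Real.pi * θ)| := by
  have hfac : (1 + Complex.exp (((2 * Real.pi * θ : ℝ) : ℂ) * Complex.I)) =
      Complex.exp (((Real.pi * θ : ℝ) : ℂ) * Complex.I) * (2 * Complex.cos ((Real.pi * θ : ℝ) : ℂ)) := by
    rw [Complex.two_cos, mul_add, ← Complex.exp_add, ← Complex.exp_add]
    have e1 : ((Real.pi * θ : ℝ) : ℂ) * Complex.I + -((Real.pi * θ : ℝ) : ℂ) * Complex.I = 0 := by ring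
    have e2 : ((Real.pi * θ : ℝ) : ℂ) * Complex.I + ((Real.pi * θ : ℝ) : ℂ) * Complex.I =
        ((2 * Real.pi * θ : ℝ) : ℂ) * Complex.I := by push_cast; ring
    rw [e1, e2, Complex.exp_zero, add_comm]
  rw [hfac, norm_div, norm_mul, Complex.norm_exp_ofReal_mul_I, one_mul]
  have h2 : (2 * Complex.cos ((Real.pi * θ : ℝ) : ℂ)) = ((2 * Real.cos (Real.pi * θ) : ℝ) : ℂ) := by
    push_cast; rfl
  rw [h2, Complex.norm_real, Real.norm_eq_abs, abs_mul, abs_two, Complex.norm_two]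
  ring

/-- **The product formula** (Mauduit–Rivat 2009, (17), `q = 2`): for all real `h`, `α` and every `λ`,
`|F_λ(h, α)| = Π_{j<λ} |cos π(α − h 2^{-(j+1)})|`. [cite: MauduitRivat2009, (17)] -/
theorem norm_fourierCoeff_eq_prod (lam : ℕ) (h α : ℝ) :
    ‖fourierCoeff lam h α‖ = ∏ j ∈ range lam, |Real.cos (Real.pi * (α - h / 2 ^ (j + 1)))| := by
  induction lam with
  | zero => simp [fourierCoeff_zero]
  | succ lam ih =>
      rw [fourierCoeff_succ, norm_mul, ih, prod_range_succ, norm_one_add_exp_div_two, mul_comm]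

/-- `|F_λ(h, α)| ≤ 1`. [cite: MauduitRivat2009, §4.2] -/
theorem norm_fourierCoeff_le_one (lam : ℕ) (h α : ℝ) : ‖fourierCoeff lam h α‖ ≤ 1 := by
  rw [norm_fourierCoeff_eq_prod]
  exact prod_le_one (fun _ _ => abs_nonneg _) fun _ _ => Real.abs_cos_le_one _

/-! ### Lemme 7 for `q = 2`: two consecutive factors -/

/-- `cos u ≤ exp(−u²/2)` for `|u| ≤ 1` (Taylor bounds for `cos` and `exp`). [folklore] -/
theorem cos_le_exp_neg_sq_half {u : ℝ} (hu : |u| ≤ 1) : Real.cos u ≤ Real.exp (-(u ^ 2 / 2)) := by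
  have hc := Real.cos_bound hu
  set v : ℝ := u ^ 2 / 2 with hv
  have hv0 : 0 ≤ v := by positivity
  have hu2 : u ^ 2 ≤ 1 := by
    have : |u| ^ 2 ≤ 1 ^ 2 := pow_le_pow_left₀ (abs_nonneg _) hu 2
    simpa [sq_abs] using this
  have hv1 : v ≤ 1 / 2 := by rw [hv]; linarith
  -- `exp (-v) ≥ 1 - v + v²/2 - (2/9) v³`
  have he := Real.exp_bound (x := -v) (by rw [abs_neg, abs_of_nonneg hv0]; linarith) (n := 3) (by norm_num)
  have hsum : ∑ m ∈ range 3, (-v) ^ m / (m.factorial : ℝ) = 1 - v + v ^ 2 / 2 := by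
    simp [Finset.sum_range_succ, Nat.factorial]
    ring
  rw [hsum] at he
  have he' : 1 - v + v ^ 2 / 2 - |-v| ^ 3 * ((Nat.succ 3 : ℕ) / ((Nat.factorial 3 : ℕ) * (3 : ℕ) : ℝ)) ≤
      Real.exp (-v) := by
    have := (abs_sub_le_iff.1 he).2
    linarith
  rw [abs_neg, abs_of_nonneg hv0] at he'
  norm_num [Nat.factorial] at he'
  -- `cos u ≤ 1 - u²/2 + (5/96) u⁴`
  have hc' : Real.cos u ≤ 1 - u ^ 2 / 2 + |u| ^ 4 * (5 / 96) := by
    have := (abs_sub_le_iff.1 hc).1; linarith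
  have hu4 : |u| ^ 4 = 4 * v ^ 2 := by
    rw [hv, show |u| ^ 4 = (|u| ^ 2) ^ 2 by ring, sq_abs]; ring
  rw [hu4] at hc'
  have hv3 : v ^ 3 ≤ v ^ 2 * (1 / 2) := by
    rw [pow_succ]; exact mul_le_mul_of_nonneg_left hv1 (by positivity)
  have : Real.cos u ≤ Real.exp (-v) := by nlinarith
  simpa [hv] using this

/-- `|cos πx| = cos(π‖x‖)` where `‖x‖` is the distance to the nearest integer. [folklore] -/
theorem abs_cos_pi_mul_eq (x : ℝ) : |Real.cos (Real.pi * x)| = Real.cos (Real.pi * distInt x) := by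
  have h1 : Real.cos (Real.pi * x) = (-1) ^ round x * Real.cos (Real.pi * (x - round x)) := by
    have := Real.cos_add_int_mul_pi (Real.pi * (x - round x)) (round x)
    rw [show Real.pi * (x - round x) + (round x : ℝ) * Real.pi = Real.pi * x by ring] at this
    rw [this]
  rw [h1, abs_mul, abs_zpow, abs_neg, abs_one, one_zpow, one_mul]
  unfold distInt
  rw [← Real.cos_abs (Real.pi * (x - round x)), abs_mul, abs_of_pos Real.pi_pos]
  refine abs_of_nonneg (Real.cos_nonneg_of_neg_pi_div_two_le_of_le ?_ ?_)
  · have : 0 ≤ Real.pi * |x - round x| := by positivity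
    linarith [Real.pi_pos]
  · have h2 : |x - round x| ≤ 1 / 2 := abs_sub_round x
    nlinarith [Real.pi_pos]

/-- If `‖x‖ ≥ d ≥ 0` then `|cos πx| ≤ cos(πd)`. [folklore] -/
theorem abs_cos_pi_mul_le_cos {x d : ℝ} (hd0 : 0 ≤ d) (hd : d ≤ distInt x) :
    |Real.cos (Real.pi * x)| ≤ Real.cos (Real.pi * d) := by
  rw [abs_cos_pi_mul_eq]
  refine Real.cos_le_cos_of_nonneg_of_le_pi (by positivity) ?_ ?_
  · have := distInt_le_half x
    nlinarith [Real.pi_pos]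
  · exact mul_le_mul_of_nonneg_left hd Real.pi_pos.le

/-- **Lemme 7 of Mauduit–Rivat 2009 for `q = 2`**: for all real `θ`, `t`,
`|cos π(θ − t)| · |cos π(θ − 2t)| ≤ exp(−π²‖θ‖²/18)` (`‖·‖` the distance to the nearest integer):
since `θ = 2(θ − t) − (θ − 2t)`, one of `‖θ − t‖`, `‖θ − 2t‖` is at least `‖θ‖/3`, and
`cos(π‖θ‖/3) ≤ exp(−π²‖θ‖²/18)`. [cite: MauduitRivat2009, Lemme 7] -/
theorem abs_cos_mul_abs_cos_le (θ t : ℝ) :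
    |Real.cos (Real.pi * (θ - t))| * |Real.cos (Real.pi * (θ - 2 * t))| ≤
      Real.exp (-(Real.pi ^ 2 / 18) * distInt θ ^ 2) := by
  set d : ℝ := distInt θ with hd
  have hd0 : 0 ≤ d := distInt_nonneg θ
  have hdh : d ≤ 1 / 2 := distInt_le_half θ
  -- `‖θ‖ ≤ 2 ‖θ - t‖ + ‖θ - 2t‖`
  have htri : d ≤ 2 * distInt (θ - t) + distInt (θ - 2 * t) := by
    have e : θ = (θ - t) + (θ - t) + -(θ - 2 * t) := by ring
    calc d = distInt θ := rfl
      _ = distInt ((θ - t) + (θ - t) + -(θ - 2 * t)) := by rw [← e]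
      _ ≤ distInt ((θ - t) + (θ - t)) + distInt (-(θ - 2 * t)) := distInt_add_le _ _
      _ ≤ distInt (θ - t) + distInt (θ - t) + distInt (θ - 2 * t) := by
          rw [distInt_neg]; linarith [distInt_add_le (θ - t) (θ - t)]
      _ = 2 * distInt (θ - t) + distInt (θ - 2 * t) := by ring
  -- the bound `cos(π d/3) ≤ exp(-π² d²/18)`
  have hkey : Real.cos (Real.pi * (d / 3)) ≤ Real.exp (-(Real.pi ^ 2 / 18) * d ^ 2) := by
    have hu : |Real.pi * (d / 3)| ≤ 1 := by
      rw [abs_of_nonneg (by positivity)]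
      nlinarith [Real.pi_lt_d2, hdh]
    refine (cos_le_exp_neg_sq_half hu).trans (le_of_eq ?_)
    congr 1; ring
  have h1 : |Real.cos (Real.pi * (θ - t))| ≤ 1 := Real.abs_cos_le_one _
  have h2 : |Real.cos (Real.pi * (θ - 2 * t))| ≤ 1 := Real.abs_cos_le_one _
  rcases le_or_gt (d / 3) (distInt (θ - 2 * t)) with hx | hx
  · -- the second factor is small
    have hb := abs_cos_pi_mul_le_cos (by positivity) hx
    calc |Real.cos (Real.pi * (θ - t))| * |Real.cos (Real.pi * (θ - 2 * t))|
        ≤ 1 * Real.cos (Real.pi * (d / 3)) :=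
          mul_le_mul h1 hb (abs_nonneg _) zero_le_one
      _ ≤ Real.exp (-(Real.pi ^ 2 / 18) * d ^ 2) := by rw [one_mul]; exact hkey
  · -- the first factor is small
    have hy : d / 3 ≤ distInt (θ - t) := by linarith
    have hb := abs_cos_pi_mul_le_cos (by positivity) hy
    calc |Real.cos (Real.pi * (θ - t))| * |Real.cos (Real.pi * (θ - 2 * t))|
        ≤ Real.cos (Real.pi * (d / 3)) * 1 :=
          mul_le_mul hb h2 (abs_nonneg _) (Real.cos_nonneg_of_neg_pi_div_two_le_of_le
            (by nlinarith [Real.pi_pos]) (by nlinarith [Real.pi_pos]))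
      _ ≤ Real.exp (-(Real.pi ^ 2 / 18) * d ^ 2) := by rw [mul_one]; exact hkey

/-! ### Lemme 9 for `q = 2`: the uniform bound -/

/-- **Pairing consecutive factors** (the proof of Lemme 9): for all real `h`, `α` and every `λ`,
`Π_{j<λ} |cos π(α − h 2^{-(j+1)})| ≤ exp(π²‖α‖²/36) · exp(−π²‖α‖² λ/36)`, i.e.
`≤ exp(−(π²‖α‖²/36)(λ − 1))`. [cite: MauduitRivat2009, Lemme 9 (proof)] -/
theorem prod_abs_cos_le (lam : ℕ) (h α : ℝ) :
    ∏ j ∈ range lam, |Real.cos (Real.pi * (α - h / 2 ^ (j + 1)))| ≤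
      Real.exp (-(Real.pi ^ 2 / 36 * distInt α ^ 2) * ((lam : ℝ) - 1)) := by
  set c : ℝ := Real.pi ^ 2 / 36 * distInt α ^ 2 with hc
  have hc0 : 0 ≤ c := by positivity
  induction lam using Nat.twoStepInduction with
  | zero => simpa using hc0
  | one =>
      simp only [prod_range_one, Nat.cast_one, sub_self, mul_zero, Real.exp_zero]
      exact Real.abs_cos_le_one _
  | more n ih _ =>
      rw [prod_range_succ, prod_range_succ]
      have hpair : |Real.cos (Real.pi * (α - h / 2 ^ (n + 1)))| *
          |Real.cos (Real.pi * (α - h / 2 ^ (n + 1 + 1)))| ≤ Real.exp (-(2 * c)) := by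
        have := abs_cos_mul_abs_cos_le α (h / 2 ^ (n + 2))
        have e2 : 2 * (h / 2 ^ (n + 2)) = h / 2 ^ (n + 1) := by
          rw [pow_succ]; field_simp
        rw [e2, mul_comm] at this
        refine this.trans (le_of_eq ?_)
        congr 1; rw [hc]; ring
      calc (∏ j ∈ range n, |Real.cos (Real.pi * (α - h / 2 ^ (j + 1)))|) *
            |Real.cos (Real.pi * (α - h / 2 ^ (n + 1)))| * |Real.cos (Real.pi * (α - h / 2 ^ (n + 1 + 1)))|
          = (∏ j ∈ range n, |Real.cos (Real.pi * (α - h / 2 ^ (j + 1)))|) *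
            (|Real.cos (Real.pi * (α - h / 2 ^ (n + 1)))| * |Real.cos (Real.pi * (α - h / 2 ^ (n + 1 + 1)))|) := by
              ring
        _ ≤ Real.exp (-c * ((n : ℝ) - 1)) * Real.exp (-(2 * c)) :=
            mul_le_mul ih hpair (by positivity) (Real.exp_pos _).le
        _ = Real.exp (-c * (((n + 2 : ℕ) : ℝ) - 1)) := by
            rw [← Real.exp_add]; congr 1; push_cast; ring

/-- **Uniform bound for `F_λ`, real shifts** (Mauduit–Rivat 2009, Lemme 9 for `q = 2`, slightly
sharpened constant): for every `λ` and all real `h`, `α`,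
`|F_λ(h, α)| ≤ e^{π²/144} · exp(−π²‖α‖²λ/36)`. [cite: MauduitRivat2009, Lemme 9] -/
theorem norm_fourierCoeff_le (lam : ℕ) (h α : ℝ) :
    ‖fourierCoeff lam h α‖ ≤
      Real.exp (Real.pi ^ 2 / 144) * Real.exp (-(Real.pi ^ 2 / 36) * distInt α ^ 2 * lam) := by
  rw [norm_fourierCoeff_eq_prod]
  refine (prod_abs_cos_le lam h α).trans ?_
  rw [← Real.exp_add]
  refine Real.exp_le_exp.2 ?_
  have hd : distInt α ^ 2 ≤ 1 / 4 := by
    have h1 := distInt_le_half α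
    have h0 := distInt_nonneg α
    nlinarith
  nlinarith [Real.pi_pos, sq_nonneg Real.pi]

/-- **NAMED FACT — Mauduit–Rivat 2009, Lemme 9 (base `q = 2`), as printed**: for `λ ≥ 2`, `h ∈ ℤ`
and `α ∈ ℝ`, `|F_λ(h, α)| ≤ e^{π²/48} · 2^{−c₂‖α‖²λ}` with `c₂ = π²/(12 log 2)·(1 − 2/(2+1)) = π²/(36 log 2)`
(and `‖(q−1)α‖ = ‖α‖` for `q = 2`). Discharged below (`…_holds`). [cite: MauduitRivat2009, Lemme 9] -/
def mauduitRivat_fourier_sup_base2 : Prop :=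
  ∀ (lam : ℕ) (h : ℤ) (α : ℝ), 2 ≤ lam →
    ‖fourierCoeff lam h α‖ ≤
      Real.exp (Real.pi ^ 2 / 48) *
        (2 : ℝ) ^ (-(Real.pi ^ 2 / (12 * Real.log 2) * (1 - 2 / (2 + 1))) * distInt α ^ 2 * (lam : ℝ))

/-- **Discharge of `mauduitRivat_fourier_sup_base2`** (from `norm_fourierCoeff_le`:
`2^{−c₂‖α‖²λ} = exp(−π²‖α‖²λ/36)` and `e^{π²/144} ≤ e^{π²/48}`). [cite: MauduitRivat2009, Lemme 9] -/
theorem mauduitRivat_fourier_sup_base2_holds : mauduitRivat_fourier_sup_base2 := by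
  intro lam h α _
  refine (norm_fourierCoeff_le lam h α).trans ?_
  have hlog : 0 < Real.log 2 := Real.log_pos one_lt_two
  rw [Real.rpow_def_of_pos two_pos]
  have e : Real.log 2 * (-(Real.pi ^ 2 / (12 * Real.log 2) * (1 - 2 / (2 + 1))) * distInt α ^ 2 * (lam : ℝ))
      = -(Real.pi ^ 2 / 36) * distInt α ^ 2 * lam := by
    field_simp; ring
  rw [e]
  refine mul_le_mul_of_nonneg_right (Real.exp_le_exp.2 ?_) (Real.exp_pos _).le
  nlinarith [Real.pi_pos, sq_nonneg Real.pi]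

/-- **The Fourier property of `e(α s₂)`** in the unnormalised form used for Gelfond-type sums: for every
`λ` and real `α`, `t`, `|Σ_{u<2^λ} e(α s₂(u) − t u)| ≤ e^{π²/144} · 2^λ · exp(−π²‖α‖²λ/36)` (take
`h = t 2^λ`). [cite: MauduitRivat2009, Lemme 9] -/
theorem norm_sum_exp_digitSum_le (lam : ℕ) (α t : ℝ) :
    ‖∑ u ∈ range (2 ^ lam),
        Complex.exp (((2 * Real.pi * (α * ((Nat.digits 2 u).sum : ℕ) - t * u)) : ℝ) * Complex.I)‖ ≤
      Real.exp (Real.pi ^ 2 / 144) * 2 ^ lam * Real.exp (-(Real.pi ^ 2 / 36) * distInt α ^ 2 * lam) := by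
  have h := norm_fourierCoeff_le lam (t * 2 ^ lam) α
  unfold fourierCoeff at h
  rw [norm_div, Complex.norm_pow, Complex.norm_ofNat, div_le_iff₀ (by positivity)] at h
  have e : ∀ u : ℕ, ((2 * Real.pi * (α * ((Nat.digits 2 u).sum : ℕ) - t * 2 ^ lam * u / 2 ^ lam)) : ℝ) =
      2 * Real.pi * (α * ((Nat.digits 2 u).sum : ℕ) - t * u) := by
    intro u; field_simp
  simp only [e] at h
  linarith [h]


/-! ### The Fourier property of `e(α s₂)` in the Mauduit–Rivat / Müllner vocabulary -/

/-- Appending binary zeros does not change the digit sum: `s₂(u·2^a) = s₂(u)`. [folklore] -/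
theorem digitSum_mul_two_pow (u a : ℕ) : (Nat.digits 2 (u * 2 ^ a)).sum = (Nat.digits 2 u).sum := by
  induction a with
  | zero => simp
  | succ a ih =>
      have h := digitSum_two_mul_add (u * 2 ^ a) (i := 0) (by norm_num)
      simp only [add_zero, zero_add] at h
      rw [pow_succ, ← mul_assoc, mul_comm (u * 2 ^ a) 2, h, ih]

/-- **`e(α s₂) ∈ F_{γ,c}` for every `c`, with `γ(λ) = (π²/(36 log 2))‖α‖²λ − π²/(144 log 2)`** — the
Fourier property of the sum-of-digits phase in the vocabulary `MauduitRivat.HasFourierProperty` of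
the tree's Mauduit–Rivat 2015 / Müllner 2017 files (base `k = 2`, `E = ℂ`): for all digit shifts `a`,
levels `λ` and real `t`, `‖2^{-λ} Σ_{u<2^λ} e(−ut) e(α s₂(u 2^a))‖ ≤ 2^{−γ(λ)}` (Mauduit–Rivat, JEMS 17
(2015), p. 2598: "it follows from [MR2009, Lemmas 16 and 9] that `f(n) = e(α s_q(n))` … is in `F_{γ,c}`
for any `c > 0`", here with the slightly better constant of `norm_fourierCoeff_le`).
[cite: MauduitRivat2009, Lemme 9] -/
theorem hasFourierProperty_exp_digitSum (α c : ℝ) :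
    MauduitRivat.HasFourierProperty 2
      (fun lam : ℝ => Real.pi ^ 2 / (36 * Real.log 2) * distInt α ^ 2 * lam -
        Real.pi ^ 2 / (144 * Real.log 2)) c
      (fun n : ℕ => Complex.exp (((2 * Real.pi * (α * ((Nat.digits 2 n).sum : ℕ))) : ℝ) * Complex.I)) := by
  intro a lam _ t
  have e1 : ∀ u : ℕ, (𝐞 (-((u : ℝ) * t)) : ℂ) •
      Complex.exp (((2 * Real.pi * (α * ((Nat.digits 2 (u * 2 ^ a)).sum : ℕ))) : ℝ) * Complex.I) =
      Complex.exp (((2 * Real.pi * (α * ((Nat.digits 2 u).sum : ℕ) - t * 2 ^ lam * u / 2 ^ lam)) : ℝ) *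
        Complex.I) := by
    intro u
    rw [digitSum_mul_two_pow, smul_eq_mul, Real.fourierChar_apply, ← Complex.exp_add, ← add_mul]
    congr 1; push_cast; field_simp; ring
  simp_rw [e1]
  have h := norm_fourierCoeff_le lam (t * 2 ^ lam) α
  unfold fourierCoeff at h
  have hlog : 0 < Real.log 2 := Real.log_pos one_lt_two
  have eR : ((2 : ℕ) : ℝ) ^ (-(Real.pi ^ 2 / (36 * Real.log 2) * distInt α ^ 2 * (lam : ℝ) -
        Real.pi ^ 2 / (144 * Real.log 2))) =
      Real.exp (Real.pi ^ 2 / 144) * Real.exp (-(Real.pi ^ 2 / 36) * distInt α ^ 2 * lam) := by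
    rw [Nat.cast_ofNat, Real.rpow_def_of_pos two_pos, ← Real.exp_add]
    congr 1; field_simp; ring
  rw [eR]
  refine le_trans (le_of_eq ?_) h
  rw [norm_smul, norm_div, norm_inv, norm_pow, Nat.cast_ofNat, Real.norm_ofNat, Complex.norm_pow,
    Complex.norm_ofNat, div_eq_inv_mul]

end SumOfDigits


end Literature.NumberTheory.LFunctions
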